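import Summits.Schanuel.Schanuel.Theorems.ZilberEacBranchPoleFibrePoints
import Summits.Schanuel.Schanuel.Theorems.ZilberEacGrowthExponent
import HarnessLib

/-!
# Arbitrary base branches, LXXI: REAL IRRATIONAL directions with equal pole orders, I — POLE and
# ZERO fibre values are dense by THEOREM I (irrational growth exponents); no growth needed

HONEST FRAMING.  Cell `pub-schanuel` (Zilber's Exponential-Algebraic Closedness, case ladder;
host summit Schanuel), seat 2, gen 32.  After gen 31 the undecided polynomial-fibre surfaces
`{F(x₀, x₁) = 0, y₀ = R}` were those all of whose places at infinity are unbounded with a bad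
direction datum, not asymptotic to a line of rational slope and not rescued by a shear; the
simplest instance was the hyperbola `x₁² = 2x₀² + 1` (asymptotic slopes `±√2`).  Along a place
`x₀ = s^{-k}`, `x₁ = Φ(s)s^{-k}` with EQUAL pole orders and a REAL direction `Φ(0) = a` the growth
mechanism (THEOREM G) is void: `Re x₁ = a·Re x₀ + O(1)` and `Re x₀ = O(log n)` along the
exponential points (file XXXII's docstring: "nothing when `M = k`").  This file observes that no
growth is needed for a pole or a zero of the fibre value:
**`unprojectedDense_branch_poleFibre_irrational`** — fibre value `y₀ = ψ(s)s^L`, `L ≠ 0`,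
`‖Φ(s) − Φ(0)‖ = O(‖s‖^k)` (automatic for `k = 1`:
**`unprojectedDense_branch_poleFibre_irrational_one`**), `a` IRRATIONAL: along the points of
file XXXI `log ‖y₀‖ = Re x₀ = −(L/k)·log n + O(1)` and
`log ‖y₁‖ = Re x₁ = a·(−(L/k))·log n + O(1)`; the two growth exponents `−L/k`, `−aL/k` are
`ℤ`-independent, so THEOREM I of gen 8 (`unprojectedDense_of_logGrowth_irrational`: irrational
growth exponents kill every algebraic relation between two coordinates, via THEOREM H) gives
Zariski density — for every `k ≥ 1`, with no direction hypothesis beyond irrationality.  The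
companion file LXXII treats finite nonzero fibre values (growth / Kronecker dichotomy, any `k`)
and file LXXIII assembles: every polynomial fibre over every irreducible plane curve with a
simple real-irrational root of its top form is case ∧ dense (the hyperbola above included).
Decided instances of an OPEN question (Mantova–Masser, PLMS 2024 §1 p. 5); EC(3,2) OPEN; NOT
Schanuel's conjecture (neither used nor implied); EAC ⇏ SC.
-/

noncomputable section

open Filter Topology Metric Complex
open Literature.NumberTheory.Transcendental Literature.ModelTheory.Zilber
open Literature.ModelTheory.ExponentialFields

set_option linter.dupNamespace false

namespace Summit.Schanuel.Schanuel.Theorems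

/-! ## Part A. Pole / zero fibre values: THEOREM I -/

/-- **Pole / zero fibre values along a place with equal pole orders and a real IRRATIONAL
direction: dense.**  A cylinder germ `(s^{-k}, Φ(s)s^{-k}, ψ(s)s^L, e^{x₁})` (`k ≥ 1`, `L ≠ 0`,
`ψ(0) ≠ 0`, `Φ(0) = a` real irrational, `‖Φ(s) − Φ(0)‖ ≤ K‖s‖^k` near `0`) in an irreducible closed
`S` of dimension `≤ 2` has Zariski-dense exponential points: `log ‖y₀‖ = −(L/k) log n + O(1)` and
`log ‖y₁‖ = −a(L/k) log n + O(1)` along the points of file XXXI, and THEOREM I applies.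
[cite: MantovaMasser2023, §1 Further remarks, p. 5 (the question, open in general)] (new) -/
theorem unprojectedDense_branch_poleFibre_irrational {S : Set (Fin 2 ⊕ Fin 2 → ℂ)}
    (hS : IsIrreducibleClosed ℂ S) (hdim : zariskiDim ℂ S ≤ (2 : ℕ))
    {k : ℕ} (hk : 1 ≤ k) {L : ℤ} (hL : L ≠ 0) {ψ : ℂ → ℂ} (hψ : AnalyticAt ℂ ψ 0)
    (hψ0 : ψ 0 ≠ 0) {Φ : ℂ → ℂ} {a : ℝ} (ha : Irrational a) (hΦ0 : Φ 0 = a)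
    (hΦk : ∃ K : ℝ, ∀ᶠ s in 𝓝 (0 : ℂ), ‖Φ s - Φ 0‖ ≤ K * ‖s‖ ^ k)
    (hgerm : ∀ᶠ s in 𝓝[≠] (0 : ℂ),
      (Sum.elim ![(s ^ k)⁻¹, Φ s * (s ^ k)⁻¹] ![ψ s * s ^ L, Complex.exp (Φ s * (s ^ k)⁻¹)] :
        Fin 2 ⊕ Fin 2 → ℂ) ∈ S) :
    UnprojectedDense S := by
  classical
  have hk0 : k ≠ 0 := by omega
  have hkR : (0 : ℝ) < k := by exact_mod_cast Nat.pos_of_ne_zero hk0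
  obtain ⟨z, hz⟩ := IsAlgClosed.exists_pow_nat_eq (2 * Real.pi * I : ℂ) (by omega : 0 < k)
  have h2πI : (2 * Real.pi * I : ℂ) ≠ 0 := by simp [Real.pi_ne_zero, Complex.I_ne_zero]
  have hz0 : z ≠ 0 := by
    rintro rfl
    rw [zero_pow hk0] at hz
    exact h2πI hz.symm
  obtain ⟨N₀, u, s, -, -, hN₀, hu, hu0, -, -, hsu, hs0, hs, hexp⟩ :=
    exists_poleFibre_expPoints hk L hψ hψ0 hz
  have hsW : Tendsto s atTop (𝓝[≠] (0 : ℂ)) :=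
    tendsto_nhdsWithin_iff.2 ⟨hs, Eventually.of_forall hs0⟩
  obtain ⟨K, hK⟩ := hΦk
  obtain ⟨J₀, hJ₀⟩ := Filter.eventually_atTop.1
    ((hsW.eventually hgerm).and (hs.eventually hK))
  set n : ℕ → ℕ := fun m => N₀ + (J₀ + m) with hn
  have hn1 : ∀ m, 1 ≤ n m := fun m => by simp only [hn]; omega
  set p : ℕ → Fin 2 ⊕ Fin 2 → ℂ := fun m =>
    Sum.elim ![(s (J₀ + m) ^ k)⁻¹, Φ (s (J₀ + m)) * (s (J₀ + m) ^ k)⁻¹]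
      ![ψ (s (J₀ + m)) * s (J₀ + m) ^ L, Complex.exp (Φ (s (J₀ + m)) * (s (J₀ + m) ^ k)⁻¹)]
    with hp
  have hpS : ∀ m, p m ∈ S := fun m => (hJ₀ (J₀ + m) (Nat.le_add_right _ _)).1
  have hΦK : ∀ m, ‖Φ (s (J₀ + m)) - Φ 0‖ ≤ K * ‖s (J₀ + m)‖ ^ k :=
    fun m => (hJ₀ (J₀ + m) (Nat.le_add_right _ _)).2
  have hpΓ : ∀ m, p m ∈ expGraph ℂ 2 := by
    intro m
    rw [mem_expGraph_iff]
    intro i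
    rw [Literature.ModelTheory.ExponentialFields.ExponentialRing.complex_exp_eq]
    fin_cases i
    · simp [hp, hexp (J₀ + m)]
    · simp [hp]
  -- labels `ℓ = log n → ∞`
  set ℓ : ℕ → ℝ := fun m => Real.log (n m : ℝ) with hℓ
  have hℓt : Tendsto ℓ atTop atTop := by
    rw [hℓ]
    refine Real.tendsto_log_atTop.comp (tendsto_natCast_atTop_atTop.comp ?_)
    exact (tendsto_add_atTop_nat (N₀ + J₀)).congr fun m => by simp only [hn]; omega
  -- `‖s‖ = ‖z⁻¹‖·e^{−ℓ/k}·‖u‖`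
  have hns : ∀ m, ‖s (J₀ + m)‖ = ‖z⁻¹‖ * Real.exp (-(ℓ m) / k) * ‖u (J₀ + m)‖ := by
    intro m
    rw [hsu (J₀ + m), norm_mul, norm_mul,
      show (-(Real.log ((N₀ + (J₀ + m) : ℕ) : ℝ) : ℂ) / k) = ((-(ℓ m) / k : ℝ) : ℂ) by
        simp only [hℓ, hn]; push_cast; ring,
      ← Complex.ofReal_exp, Complex.norm_real, Real.norm_eq_abs, abs_of_pos (Real.exp_pos _)]
  -- the two multiplicative coordinates
  have hy0 : ∀ m, p m (Sum.inr 0) = ψ (s (J₀ + m)) * s (J₀ + m) ^ L := fun m => by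
    simp [hp]
  have hy1 : ∀ m, p m (Sum.inr 1) = Complex.exp (Φ (s (J₀ + m)) * (s (J₀ + m) ^ k)⁻¹) :=
    fun m => by simp [hp]
  have hψne : ∀ m, ψ (s (J₀ + m)) ≠ 0 := by
    intro m h0
    have := hexp (J₀ + m)
    rw [h0, zero_mul] at this
    exact Complex.exp_ne_zero _ this
  have hy0ne : ∀ m, p m (Sum.inr 0) ≠ 0 := fun m => by
    rw [hy0]
    exact mul_ne_zero (hψne m) (zpow_ne_zero _ (hs0 _))
  -- `log ‖y₀‖ = log ‖ψ(s)‖ + L·(log ‖z⁻¹‖ − ℓ/k + log ‖u‖)`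
  have hlog0 : ∀ m, Real.log ‖p m (Sum.inr 0)‖ = Real.log ‖ψ (s (J₀ + m))‖ +
      L * (Real.log ‖z⁻¹‖ + -(ℓ m) / k + Real.log ‖u (J₀ + m)‖) := by
    intro m
    have h1 : ‖ψ (s (J₀ + m))‖ ≠ 0 := norm_ne_zero_iff.2 (hψne m)
    have h2 : ‖z⁻¹‖ ≠ 0 := norm_ne_zero_iff.2 (inv_ne_zero hz0)
    have h3 : ‖u (J₀ + m)‖ ≠ 0 := norm_ne_zero_iff.2 (hu0 _)
    have h4 : Real.exp (-(ℓ m) / k) ≠ 0 := (Real.exp_pos _).ne'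
    rw [hy0, norm_mul, norm_zpow, Real.log_mul h1 (zpow_ne_zero _ (norm_ne_zero_iff.2 (hs0 _))),
      Real.log_zpow, hns m, Real.log_mul (mul_ne_zero h2 h4) h3, Real.log_mul h2 h4, Real.log_exp]
  -- `Re x₀ = log ‖y₀‖`
  have hre0 : ∀ m, ((s (J₀ + m) ^ k)⁻¹).re = Real.log ‖p m (Sum.inr 0)‖ := by
    intro m
    rw [hy0, ← hexp (J₀ + m), Complex.norm_exp, Real.log_exp]
  -- `log ‖y₁‖ = a·log ‖y₀‖ + Re((Φ(s) − Φ(0))·x₀)`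
  have hlog1 : ∀ m, Real.log ‖p m (Sum.inr 1)‖ = a * Real.log ‖p m (Sum.inr 0)‖ +
      ((Φ (s (J₀ + m)) - Φ 0) * (s (J₀ + m) ^ k)⁻¹).re := by
    intro m
    rw [hy1, Complex.norm_exp, Real.log_exp, ← hre0 m,
      show Φ (s (J₀ + m)) * (s (J₀ + m) ^ k)⁻¹ = (a : ℂ) * (s (J₀ + m) ^ k)⁻¹ +
        (Φ (s (J₀ + m)) - Φ 0) * (s (J₀ + m) ^ k)⁻¹ by rw [hΦ0]; ring,
      Complex.add_re, Complex.re_ofReal_mul]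
  have hcorr : ∀ m, |((Φ (s (J₀ + m)) - Φ 0) * (s (J₀ + m) ^ k)⁻¹).re| ≤ K := by
    intro m
    have hsk : 0 < ‖s (J₀ + m)‖ ^ k := pow_pos (norm_pos_iff.2 (hs0 _)) _
    refine (Complex.abs_re_le_norm _).trans ?_
    rw [norm_mul, norm_inv, norm_pow]
    calc ‖Φ (s (J₀ + m)) - Φ 0‖ * (‖s (J₀ + m)‖ ^ k)⁻¹ ≤ K * ‖s (J₀ + m)‖ ^ k * (‖s (J₀ + m)‖ ^ k)⁻¹ :=
          mul_le_mul_of_nonneg_right (hΦK m) (inv_nonneg.2 hsk.le)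
      _ = K := by field_simp
  -- bounded terms: `log ‖ψ(s_m)‖ → log ‖ψ 0‖`, `log ‖u_m‖ → 0`
  have hst : Tendsto (fun m => s (J₀ + m)) atTop (𝓝 0) :=
    hs.comp ((tendsto_add_atTop_nat J₀).congr fun m => by ring)
  have hut : Tendsto (fun m => u (J₀ + m)) atTop (𝓝 1) :=
    hu.comp ((tendsto_add_atTop_nat J₀).congr fun m => by ring)
  have hψlog : ∀ᶠ m in atTop, |Real.log ‖ψ (s (J₀ + m))‖| ≤ |Real.log ‖ψ 0‖| + 1 := by
    have h1 : Tendsto (fun m => Real.log ‖ψ (s (J₀ + m))‖) atTop (𝓝 (Real.log ‖ψ 0‖)) :=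
      ((Real.continuousAt_log (norm_ne_zero_iff.2 hψ0)).tendsto.comp
        ((continuous_norm.tendsto _).comp (hψ.continuousAt.tendsto.comp hst)))
    filter_upwards [Metric.tendsto_nhds.1 h1 1 one_pos] with m hm
    rw [Real.dist_eq] at hm
    have := abs_sub_abs_le_abs_sub (Real.log ‖ψ (s (J₀ + m))‖) (Real.log ‖ψ 0‖)
    linarith
  have hulog : ∀ᶠ m in atTop, |Real.log ‖u (J₀ + m)‖| ≤ 1 := by
    have h1 : Tendsto (fun m => Real.log ‖u (J₀ + m)‖) atTop (𝓝 (Real.log ‖(1 : ℂ)‖)) :=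
      ((Real.continuousAt_log (by simp)).tendsto.comp ((continuous_norm.tendsto _).comp hut))
    rw [norm_one, Real.log_one] at h1
    filter_upwards [Metric.tendsto_nhds.1 h1 1 one_pos] with m hm
    rw [Real.dist_eq, sub_zero] at hm
    exact hm.le
  -- THEOREM I
  set d : ℝ := -(L : ℝ) / k with hd
  have hd0 : d ≠ 0 := by
    rw [hd]
    exact div_ne_zero (neg_ne_zero.2 (Int.cast_ne_zero.2 hL)) hkR.ne'
  set E₀ : ℝ := |Real.log ‖ψ 0‖| + 1 + |(L : ℝ)| * (|Real.log ‖z⁻¹‖| + 1) with hE₀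
  have hE₀0 : 0 ≤ E₀ := by positivity
  have hα' : ∀ᶠ m in atTop, |Real.log ‖p m (Sum.inr 0)‖ - d * ℓ m| ≤ E₀ := by
    filter_upwards [hψlog, hulog] with m hψm hum
    have e : Real.log ‖p m (Sum.inr 0)‖ - d * ℓ m =
        Real.log ‖ψ (s (J₀ + m))‖ + (L : ℝ) * (Real.log ‖z⁻¹‖ + Real.log ‖u (J₀ + m)‖) := by
      rw [hlog0 m, hd]
      ring
    rw [e, hE₀]
    refine (abs_add_le _ _).trans (add_le_add hψm ?_)
    rw [abs_mul]
    exact mul_le_mul_of_nonneg_left ((abs_add_le _ _).trans (add_le_add le_rfl hum)) (abs_nonneg _)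
  have hα : ∀ᶠ m in atTop, p m (Sum.inr 0) ≠ 0 ∧
      |Real.log ‖p m (Sum.inr 0)‖ - d * ℓ m| ≤ |a| * E₀ + |K| + E₀ := by
    filter_upwards [hα'] with m hm
    refine ⟨hy0ne m, hm.trans ?_⟩
    have : 0 ≤ |a| * E₀ + |K| := by positivity
    linarith
  have hβ : ∀ᶠ m in atTop, p m (Sum.inr 1) ≠ 0 ∧
      |Real.log ‖p m (Sum.inr 1)‖ - a * d * ℓ m| ≤ |a| * E₀ + |K| + E₀ := by
    filter_upwards [hα'] with m hm
    refine ⟨by rw [hy1]; exact Complex.exp_ne_zero _, ?_⟩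
    have e : Real.log ‖p m (Sum.inr 1)‖ - a * d * ℓ m =
        a * (Real.log ‖p m (Sum.inr 0)‖ - d * ℓ m) +
          ((Φ (s (J₀ + m)) - Φ 0) * (s (J₀ + m) ^ k)⁻¹).re := by
      rw [hlog1 m]
      ring
    rw [e]
    refine (abs_add_le _ _).trans ?_
    rw [abs_mul]
    have h1 : |a| * |Real.log ‖p m (Sum.inr 0)‖ - d * ℓ m| ≤ |a| * E₀ :=
      mul_le_mul_of_nonneg_left hm (abs_nonneg _)
    have h2 := (hcorr m).trans (le_abs_self K)
    linarith
  exact unprojectedDense_of_logGrowth_irrational hS hdim (Sum.inr 0) (Sum.inr 1) hpS hpΓ hℓt ha hd0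
    hα hβ

/-- **`k = 1`: the Lipschitz hypothesis is automatic** (`Φ` analytic at `0`). [folklore] -/
theorem exists_norm_sub_le_mul_norm_of_analyticAt {Φ : ℂ → ℂ} (hΦ : AnalyticAt ℂ Φ 0) :
    ∃ K : ℝ, ∀ᶠ s in 𝓝 (0 : ℂ), ‖Φ s - Φ 0‖ ≤ K * ‖s‖ ^ 1 := by
  have h := hΦ.differentiableAt.hasDerivAt.isBigO_sub
  obtain ⟨K, hK⟩ := h.bound
  refine ⟨K, ?_⟩
  filter_upwards [hK] with s hs
  simpa only [sub_zero, pow_one] using hs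

/-- **Pole / zero fibre values along an unramified place with a real IRRATIONAL direction
(`k = 1`): dense**, no further hypothesis. [cite: MantovaMasser2023, §1 Further remarks, p. 5
(the question, open in general)] (new) -/
theorem unprojectedDense_branch_poleFibre_irrational_one {S : Set (Fin 2 ⊕ Fin 2 → ℂ)}
    (hS : IsIrreducibleClosed ℂ S) (hdim : zariskiDim ℂ S ≤ (2 : ℕ))
    {L : ℤ} (hL : L ≠ 0) {ψ : ℂ → ℂ} (hψ : AnalyticAt ℂ ψ 0)
    (hψ0 : ψ 0 ≠ 0) {Φ : ℂ → ℂ} (hΦ : AnalyticAt ℂ Φ 0) {a : ℝ} (ha : Irrational a) (hΦ0 : Φ 0 = a)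
    (hgerm : ∀ᶠ s in 𝓝[≠] (0 : ℂ),
      (Sum.elim ![(s ^ 1)⁻¹, Φ s * (s ^ 1)⁻¹] ![ψ s * s ^ L, Complex.exp (Φ s * (s ^ 1)⁻¹)] :
        Fin 2 ⊕ Fin 2 → ℂ) ∈ S) :
    UnprojectedDense S :=
  unprojectedDense_branch_poleFibre_irrational hS hdim le_rfl hL hψ hψ0 ha hΦ0
    (exists_norm_sub_le_mul_norm_of_analyticAt hΦ) hgerm

end Summit.Schanuel.Schanuel.Theorems

end
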